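import Literature.Barriers.BirchSwinnertonDyer.PAdicFunctionalEquationParityAnyPrimeProofs

/-!
# Parity squeeze for `ord_{T=0} L_p(E,T)` at every good ordinary prime (`p = 2` included)

Corollaries of the tree's parity-free mod-2 agreement
`even_order_padicLFunction_iff_even_analyticRank_conductorLevel_anyPrime`
(`PAdicFunctionalEquationParityAnyPrimeProofs`): the parity of `ord_{T=0} L_p(E,T)` against the ROOT
NUMBER, and the squeeze "`r - 1 ≤ ord ≤ r` and matching parity `⇒ ord = r`". At `p = 2` this turns a
certified upper bound `ord_T L_2(E,T) ≤ 2` (`order_padicLFunction_le_of_riemannSum_certificate`) for a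
curve with `w_E = +1` and `L(E,1) = 0` into the EXACT value `ord_T L_2(E,T) = 2` (crux
stmt-BirchSwinnertonDyer-0490, line `Sketch`, lead c4: certified numerics at `p = 2`).

References: R. Greenberg, LNM 1716 (1999), §5 (p. 181); B. Mazur, J. Tate, J. Teitelbaum, Invent.
Math. 84 (1986), §I.17.
-/

noncomputable section

namespace Literature.Barriers.BirchSwinnertonDyer

open scoped MatrixGroups ModularForm
open PowerSeries CongruenceSubgroup WeierstrassCurve Literature.NumberTheory.EllipticCurves
  Literature.NumberTheory.EllipticCurves.ModularForms

variable {W : WeierstrassCurve ℚ} [W.IsElliptic] [W.IsGloballyMinimal] {p : ℕ} [Fact p.Prime]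
  [NeZero (W.conductorNorm ℤ)] {f : CuspForm (Gamma0 (W.conductorNorm ℤ)) 2}

/-- **Parity of `ord_{T=0} L_p(E,T)` against the root number**, every good ordinary `p` (`p = 2`
included), conductor level: `ord_T L_p(E,T)` is even iff `w_E = 1`
(`even_order_padicLFunction_iff_even_analyticRank_conductorLevel_anyPrime` with the complex parity
`even_analyticRank_iff_of_isNewformOf_conductorLevel`).
[cite: GreenbergLNM1716, §5 (p. 181, `λ_E^{anal} = 1` passage)] -/
theorem even_order_padicLFunction_iff_rootNumber_eq_one_conductorLevel_anyPrime
    (hord : IsOrdinaryAt W p) (hf : IsNewformOf W f) :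
    Even (padicLFunction f (unitRoot W p : ℚ_[p])).order.toNat ↔ W.rootNumber = 1 := by
  rw [even_order_padicLFunction_iff_even_analyticRank_conductorLevel_anyPrime hord hf]
  exact even_analyticRank_iff_of_isNewformOf_conductorLevel hf

/-- **Parity squeeze**, every good ordinary `p` (`p = 2` included), conductor level: if
`r - 1 ≤ ord_{T=0} L_p(E,T) ≤ r` and `r` has the parity dictated by the root number
(`Even r ↔ w_E = 1`), then `ord_{T=0} L_p(E,T) = r`. The `T`-order is finite by Rohrlich
(`padicLFunction_ne_zero_holds`). [cite: GreenbergLNM1716, §5 (p. 181, `λ_E^{anal} = 1` passage)] -/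
theorem order_padicLFunction_eq_of_parity_squeeze_anyPrime (hord : IsOrdinaryAt W p)
    (hf : IsNewformOf W f) {r : ℕ} (hr : Even r ↔ W.rootNumber = 1)
    (hge : ((r - 1 : ℕ) : ℕ∞) ≤ (padicLFunction f (unitRoot W p : ℚ_[p])).order)
    (hle : (padicLFunction f (unitRoot W p : ℚ_[p])).order ≤ r) :
    (padicLFunction f (unitRoot W p : ℚ_[p])).order = r := by
  have h0 : padicLFunction f (unitRoot W p : ℚ_[p]) ≠ 0 := padicLFunction_ne_zero_holds hord hf
  have hpar := even_order_padicLFunction_iff_rootNumber_eq_one_conductorLevel_anyPrime hord hf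
  have hfin : (padicLFunction f (unitRoot W p : ℚ_[p])).order =
      ((padicLFunction f (unitRoot W p : ℚ_[p])).order.toNat : ℕ∞) := (coe_toNat_order h0).symm
  rw [hfin] at hge hle ⊢
  have hge' : r - 1 ≤ (padicLFunction f (unitRoot W p : ℚ_[p])).order.toNat := by exact_mod_cast hge
  have hle' : (padicLFunction f (unitRoot W p : ℚ_[p])).order.toNat ≤ r := by exact_mod_cast hle
  have hiff : Even (padicLFunction f (unitRoot W p : ℚ_[p])).order.toNat ↔ Even r := hpar.trans hr.symm
  have : (padicLFunction f (unitRoot W p : ℚ_[p])).order.toNat = r := by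
    rcases Nat.even_or_odd r with ⟨a, ha⟩ | ⟨a, ha⟩
    · obtain ⟨b, hb⟩ := hiff.mpr ⟨a, ha⟩
      omega
    · have hodd : ¬ Even (padicLFunction f (unitRoot W p : ℚ_[p])).order.toNat := by
        rw [hiff, Nat.not_even_iff_odd]; exact ⟨a, ha⟩
      obtain ⟨b, hb⟩ := Nat.not_even_iff_odd.mp hodd
      omega
  exact_mod_cast this

/-- **The rank-two instance used by the certified numerics at `p = 2`.** If `w_E = 1`, the constant
term of `L_p(E,T)` vanishes (`1 ≤ ord`, i.e. `L(E,1) = 0` by interpolation) and `ord_{T=0} L_p(E,T) ≤ 2`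
(e.g. certified by `order_padicLFunction_le_of_riemannSum_certificate`), then
`ord_{T=0} L_p(E,T) = 2` exactly — at every good ordinary prime, `p = 2` included.
[cite: GreenbergLNM1716, §5 (p. 181, `λ_E^{anal} = 1` passage)] -/
theorem order_padicLFunction_eq_two_of_rootNumber_eq_one_anyPrime (hord : IsOrdinaryAt W p)
    (hf : IsNewformOf W f) (hw : W.rootNumber = 1)
    (h1 : 1 ≤ (padicLFunction f (unitRoot W p : ℚ_[p])).order)
    (h2 : (padicLFunction f (unitRoot W p : ℚ_[p])).order ≤ 2) :
    (padicLFunction f (unitRoot W p : ℚ_[p])).order = 2 :=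
  order_padicLFunction_eq_of_parity_squeeze_anyPrime hord hf (r := 2)
    ⟨fun _ ↦ hw, fun _ ↦ ⟨1, rfl⟩⟩ (by exact_mod_cast h1) h2

end Literature.Barriers.BirchSwinnertonDyer

end
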